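import Summits.NavierStokesRegularity.NavierStokesRegularity.Theorems.SelfMixingDichotomyCoherentScaleExclusionMixDriftStabilityTools
import HarnessLib

/-!
# Crux `SelfMixingDichotomy.CoherentScaleExclusion` (stmt-NavierStokesRegularity-1423), line
  `registered`: tools for STUB STAB-loc `stub_mixClass_driftStability_local` — the localised
  fixed-time energy production of the difference of two passive scalars (whole space)

Support file (`--supports stmt-NavierStokesRegularity-1423`, helper, tools file 1/2) for the
registered sub-goal `stub_mixClass_driftStability_local` of the lead's skeleton
`Cruxes/CoherentScaleExclusion/Lines/birth.lean` (lead c3, wave 2: robustness of the MIX functional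
under perturbation of the drift; the LOCALISED form of the landed STAB stub
`stub_mixClass_driftStability`, files `…MixDriftStabilityTools` / `…MixDriftStability`). The cross
term of the energy method is split over a measurable set `D` and its complement, with separate sup
bounds `Mi`/`Mo` on `θ₂` and separate `L²` budgets on the drift difference.

Fixed time, no time variable (energy method for `w = θ₁ − θ₂`, identity (2.1) of
Johansson–Sorella 2024 integrated over the whole space):
* `mixDriftStabilityLocal_production_eq`: the IDENTITY `∫ 2 w d = −2 ∫ ‖Dw‖² + 2 ∫ θ₂ ⟪v, ∇w⟫`
  when `d = Δw − ⟪u₁, ∇w⟫ − ⟪v, ∇θ₂⟫` pointwise, `w`, `θ₂` decay and `u₁`, `v` are `C¹`,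
  divergence free, `L²` (`∫ w Δw = −∫ ‖Dw‖²`, `∫ w ⟪u₁, ∇w⟫ = 0`, and the polarised transport
  identity `∫ w ⟪v, ∇θ₂⟫ = −∫ θ₂ ⟪v, ∇w⟫`; same steps as `mixDriftStability_production_le_core`).
* `mixDriftStabilityLocal_production_le_core`: with `|θ₂| ≤ Mi` on `D`, `|θ₂| ≤ Mo` on `Dᶜ`,
  `∫ 2 w d ≤ Mi² ∫_D ‖v‖² + Mo² ∫_{Dᶜ} ‖v‖²` — pointwise Young
  `2 θ₂ ⟪v, ∇w⟫ ≤ ‖Dw‖² + M(x)² ‖v‖²`, `M = Mi` on `D`, `Mo` on `Dᶜ`, written with indicators and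
  integrated (`integral_indicator`; both set integrals are finite since `‖v‖² ∈ L¹`).
* `mixDriftStabilityLocal_production_le`: the same for two scalars `θ₁`, `θ₂` with their equations
  `dᵢ + ⟪uᵢ, ∇θᵢ⟫ = Δθᵢ` (`w = θ₁ − θ₂`, `v = u₁ − u₂`).

References: C. J. P. Johansson, M. Sorella, arXiv:2409.03599 (2024), Lemma 2.2 and (2.1);
A. J. Majda, A. L. Bertozzi, *Vorticity and Incompressible Flow* (CUP 2002), §3.1.1.
-/

noncomputable section

open MeasureTheory Set Function Filter Topology InnerProductSpace
open scoped ContDiff Laplacian InnerProductSpace RealInnerProductSpace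

-- `Summit = Problem` for this summit; the tree lakefile sets `weak.linter.dupNamespace = false`.
set_option linter.dupNamespace false

namespace Summit.NavierStokesRegularity.NavierStokesRegularity.Theorems

open Literature.Analysis.FluidPDE

section General

variable {E : Type*} [NormedAddCommGroup E] [InnerProductSpace ℝ E] [FiniteDimensional ℝ E]
  [MeasurableSpace E] [BorelSpace E]

/-- **The energy production of the difference, as an identity (fixed time).** Let `w : E → ℝ` be
`C²` and `θ₂ : E → ℝ` be `C¹`, both decaying with their derivatives like `(1 + ‖x‖)^{-r}`,
`dim E < r`, let `u₁`, `v` be `C¹`, divergence free and square integrable, and let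
`d = Δw − ⟪u₁, ∇w⟫ − ⟪v, ∇θ₂⟫` pointwise. Then
`∫ 2 w d = −2 ∫ ‖Dw‖² + 2 ∫ θ₂ ⟪v, ∇w⟫`: `∫ w Δw = −∫ ‖Dw‖²`
(`integral_mul_laplacian_self_eq_neg_integral_norm_fderiv_sq`), `∫ w ⟪u₁, ∇w⟫ = 0`
(`integral_mul_inner_gradient_eq_zero_of_memLp`), and `∫ w ⟪v, ∇θ₂⟫ = −∫ θ₂ ⟪v, ∇w⟫` by polarising
the transport identity for the drift `v` (`T(w + θ₂) = T(w) = T(θ₂) = 0`)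
(Johansson–Sorella 2024, identity (2.1) integrated over the whole space). -/
theorem mixDriftStabilityLocal_production_eq {w θ₂ d : E → ℝ} {u₁ v : E → E}
    (hw : ContDiff ℝ 2 w) (hθ₂ : ContDiff ℝ 1 θ₂)
    (hd : ∀ x, d x = (Δ w) x - ⟪u₁ x, gradient w x⟫ - ⟪v x, gradient θ₂ x⟫)
    (hu₁ : ContDiff ℝ 1 u₁) (hdiv₁ : VectorCalculus.IsDivFree u₁)
    (hL₁ : MemLp u₁ 2 (volume : Measure E))
    (hv : ContDiff ℝ 1 v) (hdivv : VectorCalculus.IsDivFree v)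
    (hLv : MemLp v 2 (volume : Measure E))
    {C r : ℝ} (hC : 0 ≤ C) (hr : (Module.finrank ℝ E : ℝ) < r)
    (hw0 : ∀ x, ‖w x‖ ≤ C * (1 + ‖x‖) ^ (-r)) (hw1 : ∀ x, ‖fderiv ℝ w x‖ ≤ C * (1 + ‖x‖) ^ (-r))
    (hw2 : ∀ x, ‖fderiv ℝ (fderiv ℝ w) x‖ ≤ C * (1 + ‖x‖) ^ (-r))
    (h₂0 : ∀ x, ‖θ₂ x‖ ≤ C * (1 + ‖x‖) ^ (-r))
    (h₂1 : ∀ x, ‖fderiv ℝ θ₂ x‖ ≤ C * (1 + ‖x‖) ^ (-r)) :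
    ∫ x, 2 * (w x * d x) =
      -2 * (∫ x, ‖fderiv ℝ w x‖ ^ 2) + 2 * ∫ x, θ₂ x * ⟪v x, gradient w x⟫ := by
  have hr0 : 0 ≤ r := (Nat.cast_nonneg _).trans hr.le
  have h2C : 0 ≤ 2 * C := by positivity
  have hw1c : ContDiff ℝ 1 w := hw.of_le one_le_two
  have hwd : Differentiable ℝ w := hw.differentiable two_ne_zero
  have hθ₂d : Differentiable ℝ θ₂ := hθ₂.differentiable one_ne_zero
  have hwc : Continuous w := hw.continuous
  have hθ₂c : Continuous θ₂ := hθ₂.continuous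
  have hgwc : Continuous (gradient w) := continuous_gradient_of_contDiff hw1c
  have hgθ₂c : Continuous (gradient θ₂) := continuous_gradient_of_contDiff hθ₂
  have hgw : ∀ x, ‖gradient w x‖ ≤ C * (1 + ‖x‖) ^ (-r) := fun x => by
    rw [norm_gradient_eq_norm_fderiv_real]; exact hw1 x
  have hgθ₂ : ∀ x, ‖gradient θ₂ x‖ ≤ C * (1 + ‖x‖) ^ (-r) := fun x => by
    rw [norm_gradient_eq_norm_fderiv_real]; exact h₂1 x
  -- the sum `w + θ₂` (the first scalar) and its decay
  have hs1 : ContDiff ℝ 1 (fun x => w x + θ₂ x) := hw1c.add hθ₂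
  have hs0 : ∀ x, ‖w x + θ₂ x‖ ≤ 2 * C * (1 + ‖x‖) ^ (-r) := fun x => by
    refine (norm_add_le _ _).trans ?_
    have := hw0 x; have := h₂0 x; linarith
  have hsd : ∀ x, ‖fderiv ℝ (fun y => w y + θ₂ y) x‖ ≤ 2 * C * (1 + ‖x‖) ^ (-r) := fun x => by
    rw [fderiv_fun_add (hwd x) (hθ₂d x)]
    refine (norm_add_le _ _).trans ?_
    have := hw1 x; have := h₂1 x; linarith
  have hgs : ∀ x, gradient (fun y => w y + θ₂ y) x = gradient w x + gradient θ₂ x := fun x => by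
    simp only [gradient, fderiv_fun_add (hwd x) (hθ₂d x), map_add]
  -- integrability of the pairings
  have iΔ : Integrable (fun x => w x * (Δ w) x) (volume : Measure E) := by
    refine integrable_of_norm_le_decay_mul_decay (C₁ := C) (C₂ := Module.finrank ℝ E * C)
      (r := r) (r' := r) (hwc.mul (mixDriftStability_continuous_laplacian hw)) hr hr0 hC
      (by positivity) fun x => ?_
    rw [norm_mul]
    refine mul_le_mul (hw0 x) ((norm_laplacian_le w x).trans ?_) (norm_nonneg _) (by positivity)
    rw [mul_assoc]
    gcongr
    exact hw2 x
  have iT : Integrable (fun x => w x * ⟪u₁ x, gradient w x⟫) (volume : Measure E) :=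
    mixDriftStability_integrable_mul_inner hwc hgwc hL₁ hC hC hr hw0 hgw
  have iX : Integrable (fun x => w x * ⟪v x, gradient θ₂ x⟫) (volume : Measure E) :=
    mixDriftStability_integrable_mul_inner hwc hgθ₂c hLv hC hC hr hw0 hgθ₂
  have iY : Integrable (fun x => θ₂ x * ⟪v x, gradient w x⟫) (volume : Measure E) :=
    mixDriftStability_integrable_mul_inner hθ₂c hgwc hLv hC hC hr h₂0 hgw
  have iW : Integrable (fun x => w x * ⟪v x, gradient w x⟫) (volume : Measure E) :=
    mixDriftStability_integrable_mul_inner hwc hgwc hLv hC hC hr hw0 hgw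
  have i2 : Integrable (fun x => θ₂ x * ⟪v x, gradient θ₂ x⟫) (volume : Measure E) :=
    mixDriftStability_integrable_mul_inner hθ₂c hgθ₂c hLv hC hC hr h₂0 hgθ₂
  -- Green's identity and the transport identities
  have hG : ∫ x, w x * (Δ w) x = -∫ x, ‖fderiv ℝ w x‖ ^ 2 :=
    integral_mul_laplacian_self_eq_neg_integral_norm_fderiv_sq hw hC hr hw0 hw1 hw2
  have hT : ∫ x, w x * ⟪u₁ x, gradient w x⟫ = 0 :=
    integral_mul_inner_gradient_eq_zero_of_memLp hu₁ hdiv₁ hL₁ hw1c hC hr hw0 hw1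
  have hTs : ∫ x, (w x + θ₂ x) * ⟪v x, gradient (fun y => w y + θ₂ y) x⟫ = 0 :=
    integral_mul_inner_gradient_eq_zero_of_memLp hv hdivv hLv hs1 h2C hr hs0 hsd
  have hTw : ∫ x, w x * ⟪v x, gradient w x⟫ = 0 :=
    integral_mul_inner_gradient_eq_zero_of_memLp hv hdivv hLv hw1c hC hr hw0 hw1
  have hT2 : ∫ x, θ₂ x * ⟪v x, gradient θ₂ x⟫ = 0 :=
    integral_mul_inner_gradient_eq_zero_of_memLp hv hdivv hLv hθ₂ hC hr h₂0 h₂1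
  -- polarisation: `∫ w ⟪v, ∇θ₂⟫ = -∫ θ₂ ⟪v, ∇w⟫`
  have hpol : ∫ x, w x * ⟪v x, gradient θ₂ x⟫ = -∫ x, θ₂ x * ⟪v x, gradient w x⟫ := by
    have iWX : Integrable (fun x => w x * ⟪v x, gradient w x⟫ + w x * ⟪v x, gradient θ₂ x⟫)
        (volume : Measure E) := iW.add iX
    have iWXY : Integrable (fun x => w x * ⟪v x, gradient w x⟫ + w x * ⟪v x, gradient θ₂ x⟫ +
        θ₂ x * ⟪v x, gradient w x⟫) (volume : Measure E) := iWX.add iY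
    have hsplit : ∫ x, (w x + θ₂ x) * ⟪v x, gradient (fun y => w y + θ₂ y) x⟫ =
        ∫ x, (w x * ⟪v x, gradient w x⟫ + w x * ⟪v x, gradient θ₂ x⟫ +
          θ₂ x * ⟪v x, gradient w x⟫ + θ₂ x * ⟪v x, gradient θ₂ x⟫) := by
      refine integral_congr_ae (Eventually.of_forall fun x => ?_)
      simp only [hgs x, inner_add_right]
      ring
    rw [integral_add iWXY i2, integral_add iWX iY, integral_add iW iX, hTw, hT2, hTs] at hsplit
    linarith
  -- assemble
  have hww : ∀ x, 2 * (w x * d x) = 2 * (w x * (Δ w) x) - 2 * (w x * ⟪u₁ x, gradient w x⟫) -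
      2 * (w x * ⟪v x, gradient θ₂ x⟫) := fun x => by rw [hd x]; ring
  have j1 : Integrable (fun x => 2 * (w x * (Δ w) x)) (volume : Measure E) := iΔ.const_mul _
  have j2 : Integrable (fun x => 2 * (w x * ⟪u₁ x, gradient w x⟫)) (volume : Measure E) :=
    iT.const_mul _
  have j3 : Integrable (fun x => 2 * (w x * ⟪v x, gradient θ₂ x⟫)) (volume : Measure E) :=
    iX.const_mul _
  have j12 : Integrable (fun x => 2 * (w x * (Δ w) x) - 2 * (w x * ⟪u₁ x, gradient w x⟫))
      (volume : Measure E) := j1.sub j2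
  simp_rw [hww]
  rw [integral_sub j12 j3, integral_sub j1 j2, integral_const_mul, integral_const_mul,
    integral_const_mul, hG, hT, hpol]
  ring

/-- **The energy production of the difference, localised Young step (core form, fixed time).**
In the setting of `mixDriftStabilityLocal_production_eq`, let `D` be a measurable set with
`|θ₂| ≤ Mi` on `D` and `|θ₂| ≤ Mo` on `Dᶜ`. Then
`∫ 2 w d ≤ Mi² ∫_D ‖v‖² + Mo² ∫_{Dᶜ} ‖v‖²`: pointwise Young
`2 θ₂ ⟪v, ∇w⟫ ≤ ‖Dw‖² + M(x)² ‖v‖²` with `M = Mi` on `D`, `M = Mo` on `Dᶜ`, written with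
indicators and integrated (`integral_indicator`). -/
theorem mixDriftStabilityLocal_production_le_core {w θ₂ d : E → ℝ} {u₁ v : E → E} {D : Set E}
    (hD : MeasurableSet D) (hw : ContDiff ℝ 2 w) (hθ₂ : ContDiff ℝ 1 θ₂)
    (hd : ∀ x, d x = (Δ w) x - ⟪u₁ x, gradient w x⟫ - ⟪v x, gradient θ₂ x⟫)
    (hu₁ : ContDiff ℝ 1 u₁) (hdiv₁ : VectorCalculus.IsDivFree u₁)
    (hL₁ : MemLp u₁ 2 (volume : Measure E))
    (hv : ContDiff ℝ 1 v) (hdivv : VectorCalculus.IsDivFree v)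
    (hLv : MemLp v 2 (volume : Measure E))
    {C r Mi Mo : ℝ} (hC : 0 ≤ C) (hr : (Module.finrank ℝ E : ℝ) < r)
    (hw0 : ∀ x, ‖w x‖ ≤ C * (1 + ‖x‖) ^ (-r)) (hw1 : ∀ x, ‖fderiv ℝ w x‖ ≤ C * (1 + ‖x‖) ^ (-r))
    (hw2 : ∀ x, ‖fderiv ℝ (fderiv ℝ w) x‖ ≤ C * (1 + ‖x‖) ^ (-r))
    (h₂0 : ∀ x, ‖θ₂ x‖ ≤ C * (1 + ‖x‖) ^ (-r))
    (h₂1 : ∀ x, ‖fderiv ℝ θ₂ x‖ ≤ C * (1 + ‖x‖) ^ (-r))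
    (hMi : ∀ x ∈ D, |θ₂ x| ≤ Mi) (hMo : ∀ x ∈ Dᶜ, |θ₂ x| ≤ Mo) :
    ∫ x, 2 * (w x * d x) ≤
      Mi ^ 2 * (∫ x in D, ‖v x‖ ^ 2) + Mo ^ 2 * (∫ x in Dᶜ, ‖v x‖ ^ 2) := by
  have hr0 : 0 ≤ r := (Nat.cast_nonneg _).trans hr.le
  have hw1c : ContDiff ℝ 1 w := hw.of_le one_le_two
  have hθ₂c : Continuous θ₂ := hθ₂.continuous
  have hgwc : Continuous (gradient w) := continuous_gradient_of_contDiff hw1c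
  have hgw : ∀ x, ‖gradient w x‖ ≤ C * (1 + ‖x‖) ^ (-r) := fun x => by
    rw [norm_gradient_eq_norm_fderiv_real]; exact hw1 x
  have iY : Integrable (fun x => θ₂ x * ⟪v x, gradient w x⟫) (volume : Measure E) :=
    mixDriftStability_integrable_mul_inner hθ₂c hgwc hLv hC hC hr h₂0 hgw
  have hv2 : Integrable (fun x => ‖v x‖ ^ 2) (volume : Measure E) :=
    (memLp_two_iff_integrable_sq_norm hLv.1).1 hLv
  have hG2 : Integrable (fun x => ‖fderiv ℝ w x‖ ^ 2) (volume : Measure E) := by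
    refine integrable_of_norm_le_decay_mul_decay (C₁ := C) (C₂ := C) (r := r) (r' := r)
      ((hw.continuous_fderiv two_ne_zero).norm.pow 2) hr hr0 hC hC fun x => ?_
    rw [norm_pow, norm_norm, sq]
    exact mul_le_mul (hw1 x) (hw1 x) (norm_nonneg _) (by positivity)
  have iI : Integrable (D.indicator fun x => Mi ^ 2 * ‖v x‖ ^ 2) (volume : Measure E) :=
    (hv2.const_mul _).indicator hD
  have iO : Integrable (Dᶜ.indicator fun x => Mo ^ 2 * ‖v x‖ ^ 2) (volume : Measure E) :=
    (hv2.const_mul _).indicator hD.compl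
  have i5 : Integrable (fun x => ‖fderiv ℝ w x‖ ^ 2 + D.indicator (fun x => Mi ^ 2 * ‖v x‖ ^ 2) x)
      (volume : Measure E) := hG2.add iI
  have i6 : Integrable (fun x => ‖fderiv ℝ w x‖ ^ 2 + D.indicator (fun x => Mi ^ 2 * ‖v x‖ ^ 2) x
      + Dᶜ.indicator (fun x => Mo ^ 2 * ‖v x‖ ^ 2) x) (volume : Measure E) := i5.add iO
  -- pointwise Young with the local constant
  have hpt : ∀ x, 2 * (θ₂ x * ⟪v x, gradient w x⟫) ≤
      ‖fderiv ℝ w x‖ ^ 2 + D.indicator (fun x => Mi ^ 2 * ‖v x‖ ^ 2) x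
        + Dᶜ.indicator (fun x => Mo ^ 2 * ‖v x‖ ^ 2) x := by
    intro x
    have hin : |⟪v x, gradient w x⟫| ≤ ‖v x‖ * ‖fderiv ℝ w x‖ := by
      rw [← norm_gradient_eq_norm_fderiv_real]; exact abs_real_inner_le_norm _ _
    have hle := le_abs_self (θ₂ x * ⟪v x, gradient w x⟫)
    have hY : ∀ M : ℝ, |θ₂ x| ≤ M →
        2 * (θ₂ x * ⟪v x, gradient w x⟫) ≤ ‖fderiv ℝ w x‖ ^ 2 + M ^ 2 * ‖v x‖ ^ 2 := by
      intro M hM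
      have hM0 : 0 ≤ M := (abs_nonneg _).trans hM
      have hprod : |θ₂ x * ⟪v x, gradient w x⟫| ≤ M * (‖v x‖ * ‖fderiv ℝ w x‖) := by
        rw [abs_mul]; exact mul_le_mul hM hin (abs_nonneg _) hM0
      nlinarith [sq_nonneg (‖fderiv ℝ w x‖ - M * ‖v x‖)]
    by_cases hx : x ∈ D
    · rw [indicator_of_mem hx, indicator_of_notMem (notMem_compl_iff.2 hx), add_zero]
      exact hY Mi (hMi x hx)
    · rw [indicator_of_notMem hx, add_zero, indicator_of_mem (mem_compl hx)]
      exact hY Mo (hMo x (mem_compl hx))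
  have hYI : 2 * ∫ x, θ₂ x * ⟪v x, gradient w x⟫ ≤ (∫ x, ‖fderiv ℝ w x‖ ^ 2)
      + Mi ^ 2 * (∫ x in D, ‖v x‖ ^ 2) + Mo ^ 2 * (∫ x in Dᶜ, ‖v x‖ ^ 2) := by
    calc 2 * ∫ x, θ₂ x * ⟪v x, gradient w x⟫ = ∫ x, 2 * (θ₂ x * ⟪v x, gradient w x⟫) :=
          (integral_const_mul _ _).symm
      _ ≤ ∫ x, (‖fderiv ℝ w x‖ ^ 2 + D.indicator (fun x => Mi ^ 2 * ‖v x‖ ^ 2) x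
            + Dᶜ.indicator (fun x => Mo ^ 2 * ‖v x‖ ^ 2) x) :=
          integral_mono (iY.const_mul _) i6 hpt
      _ = (∫ x, ‖fderiv ℝ w x‖ ^ 2) + Mi ^ 2 * (∫ x in D, ‖v x‖ ^ 2)
            + Mo ^ 2 * (∫ x in Dᶜ, ‖v x‖ ^ 2) := by
          rw [integral_add i5 iO, integral_add hG2 iI, integral_indicator hD,
            integral_indicator hD.compl, integral_const_mul, integral_const_mul]
  have hGnn : 0 ≤ ∫ x, ‖fderiv ℝ w x‖ ^ 2 := integral_nonneg fun x => sq_nonneg _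
  rw [mixDriftStabilityLocal_production_eq hw hθ₂ hd hu₁ hdiv₁ hL₁ hv hdivv hLv hC hr hw0 hw1 hw2
    h₂0 h₂1]
  linarith

/-- **The localised energy production of the difference of two passive scalars (fixed time).**
For `C²` scalars `θ₁`, `θ₂` decaying with two derivatives like `(1 + ‖x‖)^{-r}`, `dim E < r`,
satisfying `dᵢ + ⟪uᵢ, ∇θᵢ⟫ = Δθᵢ` pointwise with `C¹`, divergence-free, square-integrable drifts
`u₁`, `u₂`, a measurable set `D` with `|θ₂| ≤ Mi` on `D` and `|θ₂| ≤ Mo` on `Dᶜ`: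
`∫ 2 (θ₁ − θ₂)(d₁ − d₂) ≤ Mi² ∫_D ‖u₁ − u₂‖² + Mo² ∫_{Dᶜ} ‖u₁ − u₂‖²`
(`mixDriftStabilityLocal_production_le_core` with `w = θ₁ − θ₂`, `v = u₁ − u₂`). -/
theorem mixDriftStabilityLocal_production_le {θ₁ θ₂ d₁ d₂ : E → ℝ} {u₁ u₂ : E → E}
    {D : Set E} (hD : MeasurableSet D) (hθ₁ : ContDiff ℝ 2 θ₁) (hθ₂ : ContDiff ℝ 2 θ₂)
    (he₁ : ∀ x, d₁ x + ⟪u₁ x, gradient θ₁ x⟫ = (Δ θ₁) x)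
    (he₂ : ∀ x, d₂ x + ⟪u₂ x, gradient θ₂ x⟫ = (Δ θ₂) x)
    (hu₁ : ContDiff ℝ 1 u₁) (hdiv₁ : VectorCalculus.IsDivFree u₁)
    (hL₁ : MemLp u₁ 2 (volume : Measure E))
    (hu₂ : ContDiff ℝ 1 u₂) (hdiv₂ : VectorCalculus.IsDivFree u₂)
    (hL₂ : MemLp u₂ 2 (volume : Measure E))
    {C r Mi Mo : ℝ} (hC : 0 ≤ C) (hr : (Module.finrank ℝ E : ℝ) < r)
    (h₁0 : ∀ x, ‖θ₁ x‖ ≤ C * (1 + ‖x‖) ^ (-r)) (h₁1 : ∀ x, ‖fderiv ℝ θ₁ x‖ ≤ C * (1 + ‖x‖) ^ (-r))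
    (h₁2 : ∀ x, ‖fderiv ℝ (fderiv ℝ θ₁) x‖ ≤ C * (1 + ‖x‖) ^ (-r))
    (h₂0 : ∀ x, ‖θ₂ x‖ ≤ C * (1 + ‖x‖) ^ (-r)) (h₂1 : ∀ x, ‖fderiv ℝ θ₂ x‖ ≤ C * (1 + ‖x‖) ^ (-r))
    (h₂2 : ∀ x, ‖fderiv ℝ (fderiv ℝ θ₂) x‖ ≤ C * (1 + ‖x‖) ^ (-r))
    (hMi : ∀ x ∈ D, |θ₂ x| ≤ Mi) (hMo : ∀ x ∈ Dᶜ, |θ₂ x| ≤ Mo) :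
    ∫ x, 2 * ((θ₁ x - θ₂ x) * (d₁ x - d₂ x)) ≤
      Mi ^ 2 * (∫ x in D, ‖u₁ x - u₂ x‖ ^ 2) + Mo ^ 2 * (∫ x in Dᶜ, ‖u₁ x - u₂ x‖ ^ 2) := by
  have h2C : 0 ≤ 2 * C := by positivity
  have hd₁ : Differentiable ℝ θ₁ := hθ₁.differentiable two_ne_zero
  have hd₂ : Differentiable ℝ θ₂ := hθ₂.differentiable two_ne_zero
  have hD₁ : Differentiable ℝ (fderiv ℝ θ₁) :=
    (hθ₁.fderiv_right (m := 1) (by norm_num)).differentiable one_ne_zero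
  have hD₂ : Differentiable ℝ (fderiv ℝ θ₂) :=
    (hθ₂.fderiv_right (m := 1) (by norm_num)).differentiable one_ne_zero
  have hfw : fderiv ℝ (fun y => θ₁ y - θ₂ y) = fun y => fderiv ℝ θ₁ y - fderiv ℝ θ₂ y :=
    funext fun y => fderiv_fun_sub (hd₁ y) (hd₂ y)
  refine mixDriftStabilityLocal_production_le_core (w := fun x => θ₁ x - θ₂ x) (θ₂ := θ₂)
    (d := fun x => d₁ x - d₂ x) (u₁ := u₁) (v := fun x => u₁ x - u₂ x) hD
    (hθ₁.sub hθ₂) (hθ₂.of_le one_le_two) (fun x => ?_) hu₁ hdiv₁ hL₁ (hu₁.sub hu₂) (fun x => ?_)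
    (hL₁.sub hL₂) h2C hr (fun x => ?_) (fun x => ?_) (fun x => ?_)
    (fun x => le_decay_of_le_decay x (h₂0 x) (by linarith))
    (fun x => le_decay_of_le_decay x (h₂1 x) (by linarith)) hMi hMo
  · -- the equation for `w = θ₁ - θ₂`
    have hg : gradient (fun y => θ₁ y - θ₂ y) x = gradient θ₁ x - gradient θ₂ x :=
      gradient_sub_apply hd₁ hd₂ x
    have hΔ : (Δ (fun y => θ₁ y - θ₂ y)) x = (Δ θ₁) x - (Δ θ₂) x :=
      laplacian_sub_apply_of_contDiff hθ₁ hθ₂ x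
    rw [hg, hΔ, inner_sub_right, inner_sub_left]
    have e₁ := he₁ x
    have e₂ := he₂ x
    linarith
  · -- `div (u₁ - u₂) = 0`
    have e : VectorCalculus.divergence (fun y => u₁ y - u₂ y) x =
        VectorCalculus.divergence u₁ x - VectorCalculus.divergence u₂ x := by
      simp only [VectorCalculus.divergence, fderiv_fun_sub (hu₁.differentiable one_ne_zero x)
        (hu₂.differentiable one_ne_zero x), ContinuousLinearMap.toLinearMap_sub, map_sub]
    rw [e, hdiv₁ x, hdiv₂ x, sub_zero]
  · refine (norm_sub_le _ _).trans ?_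
    have := h₁0 x; have := h₂0 x; linarith
  · rw [hfw]
    refine (norm_sub_le _ _).trans ?_
    have := h₁1 x; have := h₂1 x; linarith
  · rw [hfw, fderiv_fun_sub (hD₁ x) (hD₂ x)]
    refine (norm_sub_le (fderiv ℝ (fderiv ℝ θ₁) x) (fderiv ℝ (fderiv ℝ θ₂) x)).trans ?_
    have := h₁2 x; have := h₂2 x; linarith

end General

end Summit.NavierStokesRegularity.NavierStokesRegularity.Theorems

end
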